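import Summits.QuantumFields.BalabanUV.Beta.EriceFlowEnclosureB12AsPrintedHistoryContagionShiftFlowRepinTail

/-!
# Beta / EriceFlowEnclosureB12AsPrintedHistoryContagionShiftFlowZero — ASYMPTOTIC FREEDOM IS CONTAGIOUS, part 32: THE VALUE AT THE ZERO HISTORY.  A functional `B` with a memory profile `(C_m, θ)` on the box ]0, γ]^ℕ (θ < 1) is
# uniformly continuous for the weighted distance `Σ_j θ^j |u_j − u′_j|`, so it has ONE VALUE AT THE ZERO HISTORY: a number β₀ with **`|B(u) − β₀| ≤ C_m·Σ_j θ^j u_j`**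
# for every box history (§50 `exists_valueAtZero` ∕ `valueAtZero_unique`; on ]0, a]-valued histories `|B − β₀| ≤ C_m a∕(1 − θ)`) — the functional's «one-loop
# coefficient», read off the functional alone (no definition is introduced: β₀ is carried as the letter `h0`).  ONE asymptotically free box solution t of the flow
# with memory `MemFlow B g* t` (`1∕t_a² + β*·m ≤ 1∕t(m)²`, β* > 0) then forces **`β* ≤ β₀`** (§51 `rate_le_valueAtZero`: far in the ultraviolet the increments of
# 1∕t² are β₀ + o(1), and a profile of rate β* > β₀ cannot be sustained) — so β₀ > 0 and B is FLOORED AND CAPPED on every small box: `β₀ − C_m a∕(1−θ) ≤ B ≤ β₀ +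
# C_m a∕(1−θ)` on ]0, a]^ℕ (§50): near the zero history the floor-free setting of parts 10–31 IS node U2's original floored setting, and on ]0, a] with
# `3C_m a ≤ β₀(1 − θ)` even node U2's original contraction regime `C_m a < b(1 − θ)` (§51 `smallBox_regime`, `existsUnique_memFlow_smallBox` — `T4BetaFlowWellPosed`
# §4 BY NAME): ASYMPTOTIC FREEDOM PUTS THE ULTRAVIOLET END OF EVERY TRAJECTORY IN NODE U2's ORIGINAL REGIME.  The consequences — the one-loop law and the universal
# clock `m·t(m)² → 1∕β₀` of every AF trajectory (part 33 `…ZeroClock`), the relative Λ-parameter near zero pin with its Abel equation `Λ(R g) = Λ(g) + β₀` (parts 34–35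
# `…ZeroOffset` ∕ `…ZeroLambda`), the carrier ENDs (part 36) and the witnesses (part 37) — follow in this generation's companions.
# Abstract in B (β-flow team, prover 1, unit `b2b-balaban-beta-bflow-p1`, gen 39; ROW AP-I·Uc × NODE U2 — the value at the zero history)

HONEST FRAMING (page 1 of everything the β sub-cell writes): discharging `BetaPertH` makes Bałaban's UV stability UNCONDITIONAL — a
real constructive-QFT result; it is NOT the continuum limit and NOT the Clay problem.  HONEST DEPENDENCY (cell reorg 2026-08-19,
verbatim): «continuum YM on T⁴ ⇐ BetaPertH ∧ nine spine estimates (0/9 proved); BetaPertH ⇐ (D1) ∧ (D4) ∧ CAP+tail; G-an2-4 gates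
asym, D1 and NE2/3/4.»  THIS MODULE DISCHARGES NOTHING: elementary real analysis (a Cauchy sequence of values on constant histories, a telescoping sum against a
square-root profile, Archimedes) over node U2's HYPOTHESIS SHAPES `T4BetaStationary.{SeqBox, MemoryProfile}`, `T4BetaFlowWellPosed.{MemFlow, solution}` on an ABSTRACT
functional `B`; node U2's `existsUnique_memFlow ∕ eq_solution_of_memFlow` (§4), `Probes.summable_weighted`, `T4CouplingMatching.sprof`, part 10's
`invSq_lower_of_reference_flow`, part 13's `memFlow_solution_of_reference`, part 25's `tail_profile ∕ exists_tail_scale_le` and `…HistoryUniformDepth.sum_invSprof_le` BY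
NAME — nothing restated.  PRECEDENTS (by name, not restated, not imported): prover 2's gen-46 `…PointwiseFadingEventualAF.const_ge_of_runs_NE4` derives a floor of the
LATTICE family near zero from runs + NE4 (the lattice shadow of §51); d4-p2's (E52e) `EriceRemainderEnclosureHistoryAutonomyFunctionalShiftMemoryless.abs_invSq_sub_oneLoop_le_sum`
is the one-loop telescoping GIVEN a floor on the whole box and GIVEN the constant b₀ as data — here the floor and the constant are DERIVED from the memory profile and one AF
solution, on a box of any size.  `ScaleShiftRate` (GAPS G-t4-U2-1), `HistLipschitz`∕`FadingMemory` (G-t4-U2-2) and [I] THEOREM 2 (p. 259, STATED WITHOUT PROOF) do not occur in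
this abstract part (the carrier END is part 36); NOTHING is asserted about Bałaban's actual β: whether ITS limit functional has the printed one-loop coefficient
`β₀ = 11∕(3(4π)²)·…` at the zero history is Erice's (3.73)∕(3.75) (pp. 249–250) read for the limit — NOT PRINTED for the functional with memory ([I] p. 298).
[I] = T. Bałaban, Commun. Math. Phys. **109** (1987) 249–301 [Balaban1987RG1].

WHAT THIS FILE PROVES (0 sorry, 0 def): §50 `tsum_weighted_le`, `tsum_weighted_nonneg`, **`exists_valueAtZero`**, **`valueAtZero_unique`**, `existsUnique_valueAtZero`,
`abs_sub_valueAtZero_le`, `valueAtZero_sub_le` ∕ `le_valueAtZero_add` (derived floor ∕ cap on small boxes); §51 `tail_le_invSprof`, **`rate_le_valueAtZero`**, `valueAtZero_pos`,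
**`smallBox_regime`**, `existsUnique_memFlow_smallBox`.  NOT CLAIMED: that β₀ is a VALUE of B on the box (the zero history is not in the box); anything about Bałaban's β;
`BetaPertH`; continuum; Clay.
-/

namespace Summit.QuantumFields.BalabanUV.Beta.EriceFlowEnclosureB12AsPrintedHistoryContagionShiftFlowZero

open Finset Filter Topology
open Literature.MathematicalPhysics.QuantumFieldTheory.Balaban1983to89
open Literature.MathematicalPhysics.QuantumFieldTheory.Balaban1983to89.T4CouplingMatching (prof sprof sprof_pos sprof_sq prof_pos sprof_zero)
open Literature.MathematicalPhysics.QuantumFieldTheory.Balaban1983to89.T4BetaStationary (SeqBox MemoryProfile)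
open Literature.MathematicalPhysics.QuantumFieldTheory.Balaban1983to89.T4BetaStationary.Probes (summable_weighted)
open Literature.MathematicalPhysics.QuantumFieldTheory.Balaban1983to89.T4BetaFlowWellPosed (MemFlow solution seqBox_shift existsUnique_memFlow eq_solution_of_memFlow)
open Summit.QuantumFields.BalabanUV.Beta.EriceFlowEnclosureB12AsPrintedHistoryContagionShiftFlowRepin (memoryProfile_mono le_of_profile)
open Summit.QuantumFields.BalabanUV.Beta.EriceFlowEnclosureB12AsPrintedHistoryContagionShiftFlowRepinTail (one_div_sprof_pos one_div_sprof_le invSq_one_div_sprof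
  tail_profile exists_tail_scale_le)

noncomputable section

/-! ## §50 The value at the zero history -/

/-- The θ-weighted sum of a ]0, a]-valued history is at most `a∕(1 − θ)`. [folklore] -/
theorem tsum_weighted_le {θ a : ℝ} (hθ0 : 0 ≤ θ) (hθ1 : θ < 1) {u : ℕ → ℝ} (hu : SeqBox a u) :
    ∑' j, θ ^ j * u j ≤ a / (1 - θ) := by
  have hs := summable_weighted hθ0 hθ1 hu
  have hg : Summable fun j : ℕ => θ ^ j * a := (summable_geometric_of_lt_one hθ0 hθ1).mul_right a
  calc ∑' j, θ ^ j * u j ≤ ∑' j : ℕ, θ ^ j * a :=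
        hs.tsum_le_tsum (fun j => mul_le_mul_of_nonneg_left (hu j).2 (pow_nonneg hθ0 j)) hg
    _ = (∑' j : ℕ, θ ^ j) * a := tsum_mul_right
    _ = a / (1 - θ) := by rw [tsum_geometric_of_lt_one hθ0 hθ1]; ring

/-- The θ-weighted sum of a box history is non-negative. [folklore] -/
theorem tsum_weighted_nonneg {θ a : ℝ} (hθ0 : 0 ≤ θ) {u : ℕ → ℝ} (hu : SeqBox a u) : 0 ≤ ∑' j, θ ^ j * u j :=
  tsum_nonneg fun j => mul_nonneg (pow_nonneg hθ0 j) (hu j).1.le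

/-- **THE VALUE AT THE ZERO HISTORY EXISTS.**  `B` with memory profile `(C_m, θ)` on ]0, γ]^ℕ (0 ≤ θ < 1, C_m ≥ 0, γ > 0).  THEN there is a number β₀ with
**`|B(u) − β₀| ≤ C_m·Σ_j θ^j u_j`** for EVERY box history u — the memory profile read against the zero history, which is not in the box: β₀ is the limit of B along the
constant histories `γ∕2ⁿ` (a Cauchy sequence by the profile), and the modulus passes to the limit.  β₀ is the functional's ONE-LOOP COEFFICIENT (part 33: the asymptotic speed of EVERY asymptotically free trajectory in the chart).
[folklore] -/
theorem exists_valueAtZero {B : (ℕ → ℝ) → ℝ} {Cm θ γ : ℝ} (hB : MemoryProfile Cm θ γ B) (hCm : 0 ≤ Cm) (hθ0 : 0 ≤ θ) (hθ1 : θ < 1) (hγ : 0 < γ) :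
    ∃ β₀ : ℝ, ∀ u : ℕ → ℝ, SeqBox γ u → |B u - β₀| ≤ Cm * ∑' j, θ ^ j * u j := by
  have h1θ : 0 < 1 - θ := by linarith
  -- the constant histories `γ∕2ⁿ`
  set c : ℕ → ℝ := fun n => γ * (1 / 2) ^ n with hc
  have hc0 : ∀ n, 0 < c n := fun n => by positivity
  have hcγ : ∀ n, c n ≤ γ := fun n => by
    have : ((1 : ℝ) / 2) ^ n ≤ 1 := pow_le_one₀ (by norm_num) (by norm_num)
    simpa [hc] using mul_le_of_le_one_right hγ.le this
  have hcbox : ∀ n, SeqBox γ (fun _ : ℕ => c n) := fun n _ => ⟨hc0 n, hcγ n⟩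
  set x : ℕ → ℝ := fun n => B (fun _ => c n) with hx
  -- consecutive values are geometrically close
  have hgeom : ∀ a : ℝ, ∑' j : ℕ, θ ^ j * a = a / (1 - θ) := fun a => by
    rw [tsum_mul_right, tsum_geometric_of_lt_one hθ0 hθ1]; ring
  have hstep : ∀ n, dist (x n) (x (n + 1)) ≤ Cm * γ / (1 - θ) * (1 / 2) ^ n := by
    intro n
    rw [Real.dist_eq]
    have h := hB _ _ (hcbox n) (hcbox (n + 1))
    have hcc : |c n - c (n + 1)| = γ * (1 / 2) ^ (n + 1) := by
      rw [abs_of_nonneg] <;> simp only [hc, pow_succ] <;> nlinarith [pow_pos (by norm_num : (0 : ℝ) < 1 / 2) n]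
    have hsum : ∑' j : ℕ, θ ^ j * |(fun _ : ℕ => c n) j - (fun _ : ℕ => c (n + 1)) j| = γ * (1 / 2) ^ (n + 1) / (1 - θ) := by
      simp only [hcc]; exact hgeom _
    rw [hsum] at h
    refine h.trans ?_
    rw [pow_succ]
    have : 0 ≤ Cm * γ / (1 - θ) * (1 / 2) ^ n := by positivity
    calc Cm * (γ * ((1 / 2) ^ n * (1 / 2)) / (1 - θ)) = Cm * γ / (1 - θ) * (1 / 2) ^ n * (1 / 2) := by ring
      _ ≤ Cm * γ / (1 - θ) * (1 / 2) ^ n := by nlinarith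
  have hcauchy : CauchySeq x := cauchySeq_of_le_geometric (1 / 2) (Cm * γ / (1 - θ)) (by norm_num) hstep
  obtain ⟨β₀, hβ₀⟩ := cauchySeq_tendsto_of_complete hcauchy
  refine ⟨β₀, fun u hu => ?_⟩
  -- compare B u with every x n, then let n → ∞
  have hsu := summable_weighted hθ0 hθ1 hu
  have hbound : ∀ n, |B u - β₀| ≤ Cm * ∑' j, θ ^ j * u j + (Cm * (c n / (1 - θ)) + |x n - β₀|) := by
    intro n
    have h := hB _ _ hu (hcbox n)
    have hle : ∑' j, θ ^ j * |u j - (fun _ : ℕ => c n) j| ≤ ∑' j, θ ^ j * u j + c n / (1 - θ) := by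
      have hs1 := T4BetaStationary.summable_profile hθ0 hθ1 hu (hcbox n)
      have hs2 : Summable fun j : ℕ => θ ^ j * c n := (summable_geometric_of_lt_one hθ0 hθ1).mul_right _
      calc ∑' j, θ ^ j * |u j - (fun _ : ℕ => c n) j| ≤ ∑' j, (θ ^ j * u j + θ ^ j * c n) := by
            refine hs1.tsum_le_tsum (fun j => ?_) (hsu.add hs2)
            have h1 : |u j - c n| ≤ u j + c n := by
              rw [abs_le]; constructor <;> linarith [(hu j).1, hc0 n]
            calc θ ^ j * |u j - (fun _ : ℕ => c n) j| = θ ^ j * |u j - c n| := rfl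
              _ ≤ θ ^ j * (u j + c n) := mul_le_mul_of_nonneg_left h1 (pow_nonneg hθ0 j)
              _ = θ ^ j * u j + θ ^ j * c n := by ring
        _ = ∑' j, θ ^ j * u j + ∑' j : ℕ, θ ^ j * c n := hsu.tsum_add hs2
        _ = ∑' j, θ ^ j * u j + c n / (1 - θ) := by rw [hgeom]
    have h2 : |B u - x n| ≤ Cm * ∑' j, θ ^ j * u j + Cm * (c n / (1 - θ)) := by
      calc |B u - x n| ≤ Cm * ∑' j, θ ^ j * |u j - (fun _ : ℕ => c n) j| := h
        _ ≤ Cm * (∑' j, θ ^ j * u j + c n / (1 - θ)) := mul_le_mul_of_nonneg_left hle hCm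
        _ = _ := by ring
    calc |B u - β₀| = |(B u - x n) + (x n - β₀)| := by ring_nf
      _ ≤ |B u - x n| + |x n - β₀| := abs_add_le _ _
      _ ≤ _ := by linarith
  -- the error terms vanish
  have hc_lim : Tendsto c atTop (𝓝 0) := by
    have := (tendsto_pow_atTop_nhds_zero_of_lt_one (by norm_num : (0 : ℝ) ≤ 1 / 2) (by norm_num)).const_mul γ
    simpa [hc] using this
  have hx_lim : Tendsto (fun n => |x n - β₀|) atTop (𝓝 0) := by
    have := (hβ₀.sub_const β₀).abs
    simpa using this
  have herr : Tendsto (fun n => Cm * ∑' j, θ ^ j * u j + (Cm * (c n / (1 - θ)) + |x n - β₀|)) atTop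
      (𝓝 (Cm * ∑' j, θ ^ j * u j + (Cm * (0 / (1 - θ)) + 0))) :=
    tendsto_const_nhds.add (((hc_lim.div_const _).const_mul Cm).add hx_lim)
  have := le_of_tendsto_of_tendsto' tendsto_const_nhds herr hbound
  simpa using this

/-- **THE VALUE AT THE ZERO HISTORY IS UNIQUE**: two numbers satisfying the modulus `|B(u) − β| ≤ C_m·Σ_j θ^j u_j` on the box coincide (test on the constant histories
`γ∕2ⁿ`). [folklore] -/
theorem valueAtZero_unique {B : (ℕ → ℝ) → ℝ} {Cm θ γ β₀ β₀' : ℝ} (hθ0 : 0 ≤ θ) (hθ1 : θ < 1) (hγ : 0 < γ)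
    (h0 : ∀ u : ℕ → ℝ, SeqBox γ u → |B u - β₀| ≤ Cm * ∑' j, θ ^ j * u j)
    (h0' : ∀ u : ℕ → ℝ, SeqBox γ u → |B u - β₀'| ≤ Cm * ∑' j, θ ^ j * u j) : β₀ = β₀' := by
  have h1θ : 0 < 1 - θ := by linarith
  set c : ℕ → ℝ := fun n => γ * (1 / 2) ^ n with hc
  have hc0 : ∀ n, 0 < c n := fun n => by positivity
  have hcγ : ∀ n, c n ≤ γ := fun n => by
    have : ((1 : ℝ) / 2) ^ n ≤ 1 := pow_le_one₀ (by norm_num) (by norm_num)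
    simpa [hc] using mul_le_of_le_one_right hγ.le this
  have hcbox : ∀ n, SeqBox γ (fun _ : ℕ => c n) := fun n _ => ⟨hc0 n, hcγ n⟩
  have hgeom : ∀ n, ∑' j : ℕ, θ ^ j * (fun _ : ℕ => c n) j = c n / (1 - θ) := fun n => by
    simp only; rw [tsum_mul_right, tsum_geometric_of_lt_one hθ0 hθ1]; ring
  have hbound : ∀ n, |β₀ - β₀'| ≤ 2 * Cm * (c n / (1 - θ)) := by
    intro n
    have h1 := h0 _ (hcbox n)
    have h2 := h0' _ (hcbox n)
    rw [hgeom] at h1 h2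
    calc |β₀ - β₀'| = |(B (fun _ => c n) - β₀') - (B (fun _ => c n) - β₀)| := by ring_nf
      _ ≤ |B (fun _ => c n) - β₀'| + |B (fun _ => c n) - β₀| := abs_sub _ _
      _ ≤ _ := by linarith
  have hc_lim : Tendsto c atTop (𝓝 0) := by
    have := (tendsto_pow_atTop_nhds_zero_of_lt_one (by norm_num : (0 : ℝ) ≤ 1 / 2) (by norm_num)).const_mul γ
    simpa [hc] using this
  have herr : Tendsto (fun n => 2 * Cm * (c n / (1 - θ))) atTop (𝓝 (2 * Cm * (0 / (1 - θ)))) :=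
    (hc_lim.div_const _).const_mul _
  have h := le_of_tendsto_of_tendsto' tendsto_const_nhds herr hbound
  simp only [zero_div, mul_zero] at h
  exact eq_of_abs_sub_nonpos h

/-- `∃!` form of `exists_valueAtZero` ∕ `valueAtZero_unique`: the functional has EXACTLY ONE value at the zero history. [folklore] -/
theorem existsUnique_valueAtZero {B : (ℕ → ℝ) → ℝ} {Cm θ γ : ℝ} (hB : MemoryProfile Cm θ γ B) (hCm : 0 ≤ Cm) (hθ0 : 0 ≤ θ) (hθ1 : θ < 1) (hγ : 0 < γ) :
    ∃! β₀ : ℝ, ∀ u : ℕ → ℝ, SeqBox γ u → |B u - β₀| ≤ Cm * ∑' j, θ ^ j * u j := by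
  obtain ⟨β₀, h0⟩ := exists_valueAtZero hB hCm hθ0 hθ1 hγ
  exact ⟨β₀, h0, fun β₀' h0' => valueAtZero_unique hθ0 hθ1 hγ h0' h0⟩

/-- **THE MODULUS ON SMALL HISTORIES**: if u is a box history with all entries `≤ a`, then `|B(u) − β₀| ≤ C_m·a∕(1 − θ)`. [folklore] -/
theorem abs_sub_valueAtZero_le {B : (ℕ → ℝ) → ℝ} {Cm θ γ β₀ a : ℝ} {u : ℕ → ℝ} (hCm : 0 ≤ Cm) (hθ0 : 0 ≤ θ) (hθ1 : θ < 1)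
    (h0 : ∀ u : ℕ → ℝ, SeqBox γ u → |B u - β₀| ≤ Cm * ∑' j, θ ^ j * u j) (hu : SeqBox γ u) (hua : ∀ j, u j ≤ a) :
    |B u - β₀| ≤ Cm * a / (1 - θ) := by
  have hua' : SeqBox a u := fun j => ⟨(hu j).1, hua j⟩
  calc |B u - β₀| ≤ Cm * ∑' j, θ ^ j * u j := h0 u hu
    _ ≤ Cm * (a / (1 - θ)) := mul_le_mul_of_nonneg_left (tsum_weighted_le hθ0 hθ1 hua') hCm
    _ = Cm * a / (1 - θ) := by ring

/-- **THE DERIVED FLOOR**: on box histories with entries `≤ a`, `β₀ − C_m a∕(1 − θ) ≤ B(u)`. [folklore] -/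
theorem valueAtZero_sub_le {B : (ℕ → ℝ) → ℝ} {Cm θ γ β₀ a : ℝ} {u : ℕ → ℝ} (hCm : 0 ≤ Cm) (hθ0 : 0 ≤ θ) (hθ1 : θ < 1)
    (h0 : ∀ u : ℕ → ℝ, SeqBox γ u → |B u - β₀| ≤ Cm * ∑' j, θ ^ j * u j) (hu : SeqBox γ u) (hua : ∀ j, u j ≤ a) :
    β₀ - Cm * a / (1 - θ) ≤ B u := by
  have := abs_sub_valueAtZero_le hCm hθ0 hθ1 h0 hu hua
  rw [abs_le] at this
  linarith [this.1]

/-- **THE DERIVED CAP**: on box histories with entries `≤ a`, `B(u) ≤ β₀ + C_m a∕(1 − θ)`. [folklore] -/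
theorem le_valueAtZero_add {B : (ℕ → ℝ) → ℝ} {Cm θ γ β₀ a : ℝ} {u : ℕ → ℝ} (hCm : 0 ≤ Cm) (hθ0 : 0 ≤ θ) (hθ1 : θ < 1)
    (h0 : ∀ u : ℕ → ℝ, SeqBox γ u → |B u - β₀| ≤ Cm * ∑' j, θ ^ j * u j) (hu : SeqBox γ u) (hua : ∀ j, u j ≤ a) :
    B u ≤ β₀ + Cm * a / (1 - θ) := by
  have := abs_sub_valueAtZero_le hCm hθ0 hθ1 h0 hu hua
  rw [abs_le] at this
  linarith [this.2]

/-! ## §51 One asymptotically free solution forces `β* ≤ β₀`: the floor near zero, and node U2's original regime on small boxes -/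

/-- The tail of an AF box solution beyond scale n lies below the tail scale `1∕√(1∕t_a² + β*n)`. [folklore] -/
theorem tail_le_invSprof {ta bs : ℝ} {t : ℕ → ℝ} (hta : 0 < ta) (hbs : 0 ≤ bs) (hpos : ∀ m, 0 < t m)
    (hprof : ∀ m : ℕ, 1 / ta ^ 2 + bs * (m : ℝ) ≤ 1 / (t m) ^ 2) (n j : ℕ) : t (n + j) ≤ 1 / sprof ta bs n :=
  le_of_profile (one_div_sprof_pos hta hbs n) hbs (hpos (n + j)) (tail_profile hta hbs hprof n j)

/-- **ONE ASYMPTOTICALLY FREE SOLUTION FORCES `β* ≤ β₀`.**  `B` with the value β₀ at the zero history (modulus `C_m·Σ θ^j u_j`, C_m ≥ 0, 0 ≤ θ < 1); ONE box solution t of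
`MemFlow B g* t` with the profile `1∕t_a² + β*·m ≤ 1∕t(m)²` (β* > 0, t_a > 0).  THEN **`β* ≤ β₀`**: beyond a scale n₀ the tail of t is so small that every increment
`1∕t(m+1)² − 1∕t(m)² = B(t(m+1+·))` is within ε of β₀; were β₀ < β*, the increments would stay below β* − ε and the profile of rate β* would fail at a large scale.  In
particular β₀ > 0. [folklore] -/
theorem rate_le_valueAtZero {B : (ℕ → ℝ) → ℝ} {Cm θ γ β₀ bs ta gs : ℝ} {t : ℕ → ℝ} (hCm : 0 ≤ Cm) (hθ0 : 0 ≤ θ) (hθ1 : θ < 1) (hbs : 0 < bs) (hta : 0 < ta)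
    (h0 : ∀ u : ℕ → ℝ, SeqBox γ u → |B u - β₀| ≤ Cm * ∑' j, θ ^ j * u j)
    (hts : SeqBox γ t) (htf : MemFlow B gs t) (hprof : ∀ m : ℕ, 1 / ta ^ 2 + bs * (m : ℝ) ≤ 1 / (t m) ^ 2) : bs ≤ β₀ := by
  have h1θ : 0 < 1 - θ := by linarith
  refine le_of_not_gt fun hlt => ?_
  set ε : ℝ := (bs - β₀) / 2 with hε
  have hε0 : 0 < ε := by rw [hε]; linarith
  -- a scale beyond which the tail is small against the modulus
  obtain ⟨n₀, hn₀⟩ := exists_tail_scale_le hta hbs (show 0 < ε * (1 - θ) / (Cm + 1) by positivity)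
  have hinc : ∀ m, n₀ ≤ m → 1 / t (m + 1) ^ 2 - 1 / t m ^ 2 ≤ bs - ε := by
    intro m hm
    have hm1 : n₀ ≤ m + 1 := by omega
    have htail := abs_sub_valueAtZero_le (a := 1 / sprof ta bs (m + 1)) hCm hθ0 hθ1 h0 (seqBox_shift hts (m + 1))
      (fun j => tail_le_invSprof hta hbs.le (fun q => (hts q).1) hprof (m + 1) j)
    have hsmall : Cm * (1 / sprof ta bs (m + 1)) / (1 - θ) ≤ ε := by
      have h1 := hn₀ (m + 1) hm1
      have h2 : Cm * (1 / sprof ta bs (m + 1)) ≤ Cm * (ε * (1 - θ) / (Cm + 1)) := mul_le_mul_of_nonneg_left h1 hCm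
      rw [div_le_iff₀ h1θ]
      refine h2.trans ?_
      rw [show Cm * (ε * (1 - θ) / (Cm + 1)) = ε * (1 - θ) * (Cm / (Cm + 1)) by ring]
      exact mul_le_of_le_one_right (by positivity) ((div_le_one (by positivity)).mpr (by linarith))
    have e := htf.2 m
    rw [abs_le] at htail
    linarith [htail.2]
  -- the increments below β* − ε accumulate
  have hacc : ∀ k : ℕ, 1 / t (n₀ + k) ^ 2 ≤ 1 / t n₀ ^ 2 + (k : ℝ) * (bs - ε) := by
    intro k
    induction k with
    | zero => simp
    | succ k ih =>
      have h := hinc (n₀ + k) (Nat.le_add_right _ _)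
      rw [show n₀ + (k + 1) = n₀ + k + 1 by omega]
      push_cast
      linarith
  -- against the profile of rate β*: `k·ε ≤ 1∕t(n₀)² − 1∕t_a² − β*·n₀` for every k — absurd
  obtain ⟨k, hk⟩ := exists_nat_gt ((1 / t n₀ ^ 2 - 1 / ta ^ 2 - bs * (n₀ : ℝ)) / ε)
  have h1 := hprof (n₀ + k)
  have h2 := hacc k
  push_cast at h1
  rw [div_lt_iff₀ hε0] at hk
  nlinarith

/-- The value at the zero history of a fading-memory functional with ONE asymptotically free box solution is POSITIVE. [folklore] -/
theorem valueAtZero_pos {B : (ℕ → ℝ) → ℝ} {Cm θ γ β₀ bs ta gs : ℝ} {t : ℕ → ℝ} (hCm : 0 ≤ Cm) (hθ0 : 0 ≤ θ) (hθ1 : θ < 1) (hbs : 0 < bs) (hta : 0 < ta)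
    (h0 : ∀ u : ℕ → ℝ, SeqBox γ u → |B u - β₀| ≤ Cm * ∑' j, θ ^ j * u j)
    (hts : SeqBox γ t) (htf : MemFlow B gs t) (hprof : ∀ m : ℕ, 1 / ta ^ 2 + bs * (m : ℝ) ≤ 1 / (t m) ^ 2) : 0 < β₀ :=
  hbs.trans_le (rate_le_valueAtZero hCm hθ0 hθ1 hbs hta h0 hts htf hprof)

/-- **NODE U2's ORIGINAL REGIME HOLDS ON EVERY SMALL BOX.**  `B` with memory profile `(C_m, θ)` on ]0, γ]^ℕ, its value β₀ > 0 at the zero history, and a box size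
`0 < a ≤ γ` with `3C_m a ≤ β₀(1 − θ)`.  THEN on the small box ]0, a]^ℕ: B has the memory profile `(C_m, θ)` (restriction), the FLOOR `b = (2∕3)β₀ > 0`, and node U2's
contraction condition `C_m a < b(1 − θ)` — the floored, contracting setting of `T4BetaFlowWellPosed` §4, with NO floor assumed on the big box. [folklore] -/
theorem smallBox_regime {B : (ℕ → ℝ) → ℝ} {Cm θ γ β₀ a : ℝ} (hB : MemoryProfile Cm θ γ B) (hCm : 0 ≤ Cm) (hθ0 : 0 ≤ θ) (hθ1 : θ < 1)
    (h0 : ∀ u : ℕ → ℝ, SeqBox γ u → |B u - β₀| ≤ Cm * ∑' j, θ ^ j * u j) (hβ₀ : 0 < β₀) (haγ : a ≤ γ)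
    (h3 : 3 * Cm * a ≤ β₀ * (1 - θ)) :
    MemoryProfile Cm θ a B ∧ (∀ u, SeqBox a u → 2 / 3 * β₀ ≤ B u) ∧ Cm * a < 2 / 3 * β₀ * (1 - θ) := by
  have h1θ : 0 < 1 - θ := by linarith
  refine ⟨memoryProfile_mono hB haγ, fun u hu => ?_, by nlinarith⟩
  have hfl := valueAtZero_sub_le hCm hθ0 hθ1 h0 (fun j => ⟨(hu j).1, (hu j).2.trans haγ⟩) (fun j => (hu j).2)
  have : Cm * a / (1 - θ) ≤ β₀ / 3 := by rw [div_le_iff₀ h1θ]; linarith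
  linarith

/-- **WELL-POSEDNESS IN THE SMALL BOX BY NODE U2's ORIGINAL THEOREM.**  Under `smallBox_regime`'s data, from every pin `g_IR ∈ ]0, a]` the flow with memory has EXACTLY
ONE solution valued in ]0, a], and it is node U2's `solution B g_IR` — `T4BetaFlowWellPosed.existsUnique_memFlow ∕ eq_solution_of_memFlow` BY NAME on the box ]0, a].
(Parts 12–13 ∕ 23 prove more — uniqueness among solutions in the BIG box — from an AF reference; this is the part of it that is node U2's §4 verbatim.) [folklore] -/
theorem existsUnique_memFlow_smallBox {B : (ℕ → ℝ) → ℝ} {Cm θ γ β₀ a gIR : ℝ} (hB : MemoryProfile Cm θ γ B) (hCm : 0 ≤ Cm) (hθ0 : 0 ≤ θ) (hθ1 : θ < 1)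
    (h0 : ∀ u : ℕ → ℝ, SeqBox γ u → |B u - β₀| ≤ Cm * ∑' j, θ ^ j * u j) (hβ₀ : 0 < β₀) (haγ : a ≤ γ)
    (h3 : 3 * Cm * a ≤ β₀ * (1 - θ)) (hgIR : 0 < gIR) (hgIRa : gIR ≤ a) :
    (∃! h : ℕ → ℝ, SeqBox a h ∧ MemFlow B gIR h) ∧ ∀ h : ℕ → ℝ, SeqBox a h → MemFlow B gIR h → h = solution B gIR := by
  obtain ⟨hBa, hlo, hsmall⟩ := smallBox_regime hB hCm hθ0 hθ1 h0 hβ₀ haγ h3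
  have hb : 0 < 2 / 3 * β₀ := by positivity
  exact ⟨existsUnique_memFlow hBa hCm hθ0 hθ1 hgIR hgIRa hb hlo hsmall,
    fun h hh hf => eq_solution_of_memFlow hBa hCm hθ0 hθ1 hgIR hgIRa hb hlo hsmall hh hf⟩

end

end Summit.QuantumFields.BalabanUV.Beta.EriceFlowEnclosureB12AsPrintedHistoryContagionShiftFlowZero
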